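import Mathlib
import Summits.AtomisticToContinuum.Crystallization.Theorems.ChargedEnergyGap.Negative.Unconditional
import Literature.MathematicalPhysics.StatisticalMechanics.LennardJonesClusters
import HarnessLib

/-!
# Chemical-potential sandwich for Lennard-Jones ground states

Helpers of line `Sketch`, crux `LjLaminarWindows` (stmt-AtomisticToContinuum-6711), cohesion side
(registered sub-goals `stub_chemicalPotential`, `stub_removalRecord`, `stub_windowRemoval`).

Write `E(N)` for the Lennard-Jones ground-state energy of `N` points in `ℝ³` and `e* = ⨅_Q e(Q)`
for the periodic infimum (`eStar`; `E(N)/N → e*`, `crysEnergyLimit`).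

* **Removal of a group** (`removal_group_le`, any dimension): in a ground state `x` of `N`
  particles, deleting the particles of an index set `S` is a competitor for `E(#Sᶜ)`, whence
  `∑_{S×S} V_LJ + 2 ∑_{S×Sᶜ} V_LJ ≤ 2 (E(N) − E(#Sᶜ))`.
* **Insertion of a group** (`removal_append_ge`, any dimension): adjoining `M` new distinct
  points `y` to a ground state `x` is a competitor for `E(N+M)`, whence
  `2 (E(N+M) − E(N)) ≤ 2 𝓔(y) + 2 ∑_{i,j} V_LJ(|x_i − y_j|)`.
* **Contact times** (`removal_contact_frequently`, pure real sequences): if `E(N)/N → e` then for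
  every `δ > 0`, frequently in `N`, SIMULTANEOUSLY `E(N) − E(M) ≤ (N − M)(e + δ)` for all `M ≤ N`
  and `(M − N)(e − δ) ≤ E(M) − E(N)` for all `M ≥ N` (the contact points of `N ↦ E(N) − N e`
  with its `δ`-Lipschitz lower envelope).
* **Window removal for all `N`** (`stub_windowRemoval`): for groups `S` with `#S ≥ k₀(η)` the removal
  inequality `∑_{S×S} V_LJ + 2 ∑_{S×Sᶜ} V_LJ ≤ 2 (e* + η) #S` holds for EVERY `N`, by subadditivity
  `E(N) < E(N − #S) + E(#S)` and `E(k) ≤ k(e* + η)`.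
* **The sandwich** (`stub_chemicalPotential`, `stub_removalRecord`): for Lennard-Jones in `ℝ³`,
  frequently in `N`, every ground state `x` of `N` particles satisfies, for EVERY group `S`,
  `∑_{S×S} V_LJ + 2 ∑_{S×Sᶜ} V_LJ ≤ 2 (e* + δ) #S` (uniform removal inequality) and, for every
  set `y` of `M` new distinct points, `2 (e* − δ) M ≤ 2 𝓔(y) + 2 ∑ V_LJ(|x_i − y_j|)` (uniform
  insertion inequality); in particular (`removal_siteEnergy_frequently`) every particle is bound
  by at least `|e*| − δ` (`𝓔ᵖ(x) ≤ e* + δ`) and no empty site is bound by more than `|e*| + δ`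
  (`e* − δ ≤ ∑_j V_LJ(|x_j − c|)`).
-/

noncomputable section

open scoped BigOperators
open Filter Topology
open Literature.MathematicalPhysics.StatisticalMechanics
open Summit.AtomisticToContinuum.Crystallization.Theorems.ChargedEnergyGapNegative

namespace Summit.AtomisticToContinuum.Crystallization.Theorems.LjLaminarWindowsSketch

/-! ## Removal and insertion of a group (any dimension) -/

/-- **Removal of a group.** In a Lennard-Jones ground state `x` of `N` particles in `ℝᵈ` and
for every index set `S`, the sub-configuration on `Sᶜ` is a competitor for `E(#Sᶜ)`:
`∑_{i,k ∈ S} V_LJ(|x_i − x_k|) + 2 ∑_{i ∈ S, k ∉ S} V_LJ(|x_i − x_k|) ≤ 2 (E(N) − E(#Sᶜ))`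
(diagonal terms vanish, `V_LJ(0) = 0`). [folklore] -/
theorem removal_group_le {d N : ℕ} {x : Fin N → EuclideanSpace ℝ (Fin d)}
    (hx : IsGroundState lennardJones x) (S : Finset (Fin N)) :
    ∑ i ∈ S, ∑ k ∈ S, lennardJones (dist (x i) (x k)) +
        2 * ∑ i ∈ S, ∑ k ∈ Sᶜ, lennardJones (dist (x i) (x k)) ≤
      2 * (groundStateEnergy lennardJones d N - groundStateEnergy lennardJones d Sᶜ.card) := by
  have hsplit := sum_sum_eq_add_compl (fun i k => lennardJones (dist (x i) (x k))) S
  have htot : 2 * interactionEnergy lennardJones x = ∑ i, ∑ k, lennardJones (dist (x i) (x k)) :=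
    two_mul_interactionEnergy_eq_sum_sum lennardJones lennardJones_zero x
  have hsymm : ∑ i ∈ Sᶜ, ∑ k ∈ S, lennardJones (dist (x i) (x k)) =
      ∑ i ∈ S, ∑ k ∈ Sᶜ, lennardJones (dist (x i) (x k)) := by
    rw [Finset.sum_comm]
    exact Finset.sum_congr rfl fun i _ => Finset.sum_congr rfl fun k _ => by rw [dist_comm]
  have hsub : 2 * groundStateEnergy lennardJones d Sᶜ.card ≤
      ∑ i ∈ Sᶜ, ∑ k ∈ Sᶜ, lennardJones (dist (x i) (x k)) :=
    two_mul_groundStateEnergy_card_le lennardJones lennardJones_zero neg_one_div_le_lennardJones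
      hx.1 Sᶜ
  rw [hx.2] at htot
  linarith

/-- **Insertion of a group.** Adjoining `M` distinct new points `y` (avoiding the particles of
`x`) to a Lennard-Jones ground state `x` of `N` particles in `ℝᵈ` is a competitor for
`E(N + M)`: `2 (E(N+M) − E(N)) ≤ 2 𝓔(y) + 2 ∑ᵢ ∑ⱼ V_LJ(|x_i − y_j|)`. [folklore] -/
theorem removal_append_ge {d N M : ℕ} {x : Fin N → EuclideanSpace ℝ (Fin d)}
    (hx : IsGroundState lennardJones x) {y : Fin M → EuclideanSpace ℝ (Fin d)}
    (hy : Function.Injective y) (hxy : ∀ i j, x i ≠ y j) :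
    2 * (groundStateEnergy lennardJones d (N + M) - groundStateEnergy lennardJones d N) ≤
      2 * interactionEnergy lennardJones y + 2 * ∑ i, ∑ j, lennardJones (dist (x i) (y j)) := by
  have hinj : Function.Injective (Fin.append x y) := Fin.append_injective_iff.2 ⟨hx.1, hy, hxy⟩
  have h := groundStateEnergy_lennardJones_le hinj
  rw [interactionEnergy_append lennardJones lennardJones_zero x y, hx.2] at h
  linarith

/-! ## Contact times of a sequence with linear growth -/

/-- **Contact times.** If `E(N)/N → e`, then for every `δ > 0`, frequently in `N`, simultaneously
`E(N) − E(M) ≤ (N − M)(e + δ)` for all `M ≤ N` and `(M − N)(e − δ) ≤ E(M) − E(N)` for all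
`M ≥ N`: these are the contact points of `a(N) = E(N) − N e = o(N)` with its `δ`-Lipschitz lower
envelope `inf_M (a(M) + δ|N − M|)`, and every minimiser of `M ↦ a(M) + δ|N₀ − M|` is one; such
minimisers exist and tend to infinity with `N₀`. [folklore] -/
theorem removal_contact_frequently {E : ℕ → ℝ} {e : ℝ}
    (hE : Tendsto (fun N : ℕ => E N / N) atTop (𝓝 e)) {δ : ℝ} (hδ : 0 < δ) :
    ∃ᶠ N : ℕ in atTop,
      (∀ M : ℕ, M ≤ N → E N - E M ≤ ((N : ℝ) - M) * (e + δ)) ∧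
        (∀ M : ℕ, N ≤ M → ((M : ℝ) - N) * (e - δ) ≤ E M - E N) := by
  -- the excess `a(M) = E(M) - M e` is `o(M)`
  set a : ℕ → ℝ := fun M => E M - (M : ℝ) * e with ha
  have hsmall : ∀ᶠ M : ℕ in atTop, |a M| ≤ δ / 2 * M := by
    have h1 : ∀ᶠ M : ℕ in atTop, dist (E M / M) e < δ / 2 :=
      (Metric.tendsto_nhds.1 hE) (δ / 2) (by linarith)
    have h2 : ∀ᶠ M : ℕ in atTop, 1 ≤ M := eventually_ge_atTop 1
    filter_upwards [h1, h2] with M hM hM1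
    have hMpos : (0 : ℝ) < M := by exact_mod_cast hM1
    rw [Real.dist_eq] at hM
    have : a M = (E M / M - e) * M := by
      rw [ha]
      field_simp
    rw [this, abs_mul, abs_of_pos hMpos]
    nlinarith [abs_nonneg (E M / M - e)]
  obtain ⟨R₀, hR₀⟩ := eventually_atTop.1 hsmall
  rw [frequently_atTop]
  intro N₁
  -- a crude bound for `|a M|`, `M < N₁`
  set B : ℝ := ∑ M ∈ Finset.range N₁, |a M| with hB
  have hBnn : 0 ≤ B := Finset.sum_nonneg fun M _ => abs_nonneg _
  have hBle : ∀ M, M < N₁ → |a M| ≤ B := fun M hM =>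
    Finset.single_le_sum (f := fun M => |a M|) (fun M _ => abs_nonneg _) (Finset.mem_range.2 hM)
  -- the base point `N₀`
  obtain ⟨N₀, hN₀⟩ : ∃ N₀ : ℕ, max R₀ N₁ ≤ N₀ ∧ 2 * (N₁ : ℝ) + 2 * B / δ < N₀ := by
    obtain ⟨n, hn⟩ := exists_nat_gt (max (max R₀ N₁ : ℝ) (2 * (N₁ : ℝ) + 2 * B / δ))
    refine ⟨n, ?_, lt_of_le_of_lt (le_max_right _ _) hn⟩
    have := lt_of_le_of_lt (le_max_left _ _) hn
    exact_mod_cast this.le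
  have hN₀R : R₀ ≤ N₀ := le_trans (le_max_left _ _) hN₀.1
  have hN₀N : N₁ ≤ N₀ := le_trans (le_max_right _ _) hN₀.1
  have haN₀ : a N₀ ≤ δ / 2 * N₀ := le_trans (le_abs_self _) (hR₀ N₀ hN₀R)
  -- the penalised functional and its minimiser over `[N₁, 3 N₀]`
  set Φ : ℕ → ℝ := fun M => a M + δ * |(N₀ : ℝ) - M| with hΦ
  have hΦN₀ : Φ N₀ = a N₀ := by simp [hΦ]
  have hne : (Finset.Icc N₁ (3 * N₀)).Nonempty := ⟨N₀, Finset.mem_Icc.2 ⟨hN₀N, by omega⟩⟩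
  obtain ⟨Ns, hNs, hmin⟩ := Finset.exists_min_image (Finset.Icc N₁ (3 * N₀)) Φ hne
  have hNs1 : N₁ ≤ Ns := (Finset.mem_Icc.1 hNs).1
  have hΦNs : Φ Ns ≤ Φ N₀ := hmin N₀ (Finset.mem_Icc.2 ⟨hN₀N, by omega⟩)
  -- `Ns` minimises `Φ` over all of `ℕ`
  have hglob : ∀ M : ℕ, Φ Ns ≤ Φ M := by
    intro M
    by_cases hM1 : M < N₁
    · -- below `N₁` the penalty dominates
      refine hΦNs.trans ?_
      rw [hΦN₀]
      have h1 : -B ≤ a M := by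
        have := hBle M hM1
        have := neg_abs_le (a M)
        linarith
      have h2 : |(N₀ : ℝ) - M| = (N₀ : ℝ) - M := by
        rw [abs_of_nonneg]
        have : (M : ℝ) ≤ N₁ := by exact_mod_cast hM1.le
        have : (N₁ : ℝ) ≤ N₀ := by exact_mod_cast hN₀N
        linarith
      have h3 : (M : ℝ) ≤ N₁ := by exact_mod_cast hM1.le
      have h4 : 2 * B / δ * δ = 2 * B := by field_simp
      show a N₀ ≤ a M + δ * |(N₀ : ℝ) - M|
      rw [h2]
      nlinarith [hN₀.2, h4]
    · by_cases hM2 : M ≤ 3 * N₀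
      · exact hmin M (Finset.mem_Icc.2 ⟨not_lt.1 hM1, hM2⟩)
      · -- above `3 N₀` the penalty dominates again
        refine hΦNs.trans ?_
        rw [hΦN₀]
        have hM2 : 3 * N₀ < M := not_le.1 hM2
        have hMR : R₀ ≤ M := by omega
        have h1 : -(δ / 2 * M) ≤ a M := by
          have := hR₀ M hMR
          have := neg_abs_le (a M)
          linarith
        have h2 : |(N₀ : ℝ) - M| = (M : ℝ) - N₀ := by
          rw [abs_sub_comm, abs_of_nonneg]
          have : (N₀ : ℝ) ≤ M := by exact_mod_cast (by omega : N₀ ≤ M)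
          linarith
        have h3 : (3 : ℝ) * N₀ < M := by exact_mod_cast hM2
        show a N₀ ≤ a M + δ * |(N₀ : ℝ) - M|
        rw [h2]
        nlinarith
  -- the contact property of a global minimiser
  have key : ∀ M : ℕ, a Ns - a M ≤ δ * |(Ns : ℝ) - M| := by
    intro M
    have h := hglob M
    simp only [hΦ] at h
    have h0 := abs_sub_abs_le_abs_sub ((N₀ : ℝ) - M) ((N₀ : ℝ) - Ns)
    rw [show (N₀ : ℝ) - M - ((N₀ : ℝ) - Ns) = (Ns : ℝ) - M by ring] at h0
    have h3 := mul_le_mul_of_nonneg_left h0 hδ.le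
    rw [mul_sub] at h3
    linarith
  refine ⟨Ns, hNs1, fun M hM => ?_, fun M hM => ?_⟩
  · have hMr : (M : ℝ) ≤ Ns := by exact_mod_cast hM
    have h1 := key M
    rw [abs_of_nonneg (by linarith : (0 : ℝ) ≤ (Ns : ℝ) - M)] at h1
    have h2 : E Ns - E M = a Ns - a M + ((Ns : ℝ) - M) * e := by simp only [ha]; ring
    rw [h2, show ((Ns : ℝ) - M) * (e + δ) = ((Ns : ℝ) - M) * e + δ * ((Ns : ℝ) - M) by ring]
    linarith
  · have hMr : (Ns : ℝ) ≤ M := by exact_mod_cast hM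
    have h1 := key M
    rw [abs_of_nonpos (by linarith : (Ns : ℝ) - M ≤ 0)] at h1
    have h2 : E M - E Ns = a M - a Ns + ((M : ℝ) - Ns) * e := by simp only [ha]; ring
    rw [h2, show ((M : ℝ) - Ns) * (e - δ) = ((M : ℝ) - Ns) * e - δ * ((M : ℝ) - Ns) by ring]
    linarith

/-! ## The sandwich for Lennard-Jones ground states in `ℝ³` -/

/-- **Chemical-potential sandwich (stub `stub_chemicalPotential` of line `Sketch`).** For
Lennard-Jones in `ℝ³` and every `δ > 0`, frequently in `N`, the ground-state energies satisfy
simultaneously `E(N) − E(M) ≤ (N − M)(e* + δ)` for all `M ≤ N` and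
`(M − N)(e* − δ) ≤ E(M) − E(N)` for all `M ≥ N` (`e* = ⨅_Q e(Q) = lim E(N)/N`). [folklore] -/
theorem stub_chemicalPotential :
    ∀ δ : ℝ, 0 < δ → ∃ᶠ N : ℕ in atTop,
      (∀ M : ℕ, M ≤ N → groundStateEnergy lennardJones 3 N - groundStateEnergy lennardJones 3 M ≤
          ((N : ℝ) - M) * (eStar + δ)) ∧
        (∀ M : ℕ, N ≤ M → ((M : ℝ) - N) * (eStar - δ) ≤
          groundStateEnergy lennardJones 3 M - groundStateEnergy lennardJones 3 N) := by
  intro δ hδ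
  have hE : Tendsto (fun N : ℕ => groundStateEnergy lennardJones 3 N / N) atTop (𝓝 eStar) :=
    crysEnergyLimit
  exact removal_contact_frequently hE hδ

/-- **Uniform removal / insertion inequalities at contact times (stub `stub_removalRecord` of
line `Sketch`).** For Lennard-Jones in `ℝ³` and every `δ > 0`, frequently in `N`, EVERY ground
state `x` of `N` particles satisfies: for every group `S`,
`∑_{S×S} V_LJ + 2 ∑_{S×Sᶜ} V_LJ ≤ 2 (e* + δ) #S` (removing `S` costs at least `(|e*| − δ) #S`),
and for every family `y` of `M` distinct new points,
`2 (e* − δ) M ≤ 2 𝓔(y) + 2 ∑ᵢ ∑ⱼ V_LJ(|x_i − y_j|)` (no set of `M` empty sites binds by more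
than `(|e*| + δ) M`). [folklore] -/
theorem stub_removalRecord :
    ∀ δ : ℝ, 0 < δ → ∃ᶠ N : ℕ in atTop, ∀ x : Fin N → E3, IsGroundState lennardJones x →
      (∀ S : Finset (Fin N),
          ∑ i ∈ S, ∑ k ∈ S, lennardJones (dist (x i) (x k)) +
              2 * ∑ i ∈ S, ∑ k ∈ Sᶜ, lennardJones (dist (x i) (x k)) ≤
            2 * (eStar + δ) * S.card) ∧
        (∀ (M : ℕ) (y : Fin M → E3), Function.Injective y → (∀ i j, x i ≠ y j) →
          2 * (eStar - δ) * M ≤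
            2 * interactionEnergy lennardJones y + 2 * ∑ i, ∑ j, lennardJones (dist (x i) (y j))) := by
  intro δ hδ
  refine (stub_chemicalPotential δ hδ).mono fun N hN x hx => ⟨fun S => ?_, fun M y hy hxy => ?_⟩
  · have h1 := removal_group_le hx S
    have hcard : S.card + Sᶜ.card = N := by
      rw [Finset.card_add_card_compl, Fintype.card_fin]
    have hle : Sᶜ.card ≤ N := by omega
    have h2 := hN.1 Sᶜ.card hle
    have h3 : ((N : ℝ) - (Sᶜ.card : ℕ)) = S.card := by
      have : ((S.card : ℕ) : ℝ) + ((Sᶜ.card : ℕ) : ℝ) = N := by exact_mod_cast hcard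
      linarith
    rw [h3] at h2
    linarith
  · have h1 := removal_append_ge hx hy hxy
    have h2 := hN.2 (N + M) (Nat.le_add_right N M)
    have h3 : (((N + M : ℕ) : ℝ) - N) = M := by push_cast; ring
    rw [h3] at h2
    linarith

/-- **Every particle bound by `|e*| − δ`, no empty site bound by more than `|e*| + δ`.**
For Lennard-Jones in `ℝ³` and every `δ > 0`, frequently in `N`, every ground state `x` of `N`
particles has all site energies `𝓔ᵖ(x) = ∑_{k ≠ p} V_LJ(|x_p − x_k|) ≤ e* + δ`, and every point
`c` not occupied by a particle has `e* − δ ≤ ∑_j V_LJ(|x_j − c|)`. [folklore] -/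
theorem removal_siteEnergy_frequently :
    ∀ δ : ℝ, 0 < δ → ∃ᶠ N : ℕ in atTop, ∀ x : Fin N → E3, IsGroundState lennardJones x →
      (∀ p : Fin N, siteEnergy lennardJones x p ≤ eStar + δ) ∧
        (∀ c : E3, (∀ j, x j ≠ c) → eStar - δ ≤ ∑ j, lennardJones (dist (x j) c)) := by
  intro δ hδ
  refine (stub_removalRecord δ hδ).mono fun N hN x hx => ⟨fun p => ?_, fun c hc => ?_⟩
  · have h := (hN x hx).1 {p}
    rw [Finset.sum_singleton, Finset.sum_singleton, Finset.sum_singleton, dist_self,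
      lennardJones_zero, Finset.card_singleton, Finset.compl_singleton] at h
    have hs : siteEnergy lennardJones x p =
        ∑ k ∈ Finset.univ.erase p, lennardJones (dist (x p) (x k)) := rfl
    rw [hs]
    push_cast at h
    linarith
  · have h := (hN x hx).2 1 (fun _ : Fin 1 => c) (fun i j _ => Subsingleton.elim i j)
      (fun i _ => hc i)
    rw [interactionEnergy_of_subsingleton] at h
    simp only [Finset.univ_unique, Fin.default_eq_zero, Finset.sum_singleton, Nat.cast_one,
      mul_one, mul_zero, zero_add] at h
    linarith

/-! ## Window removal for all `N` (subadditivity form) -/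

/-- **Window removal, all `N` (stub `stub_windowRemoval` of line `Sketch`).** For every `η > 0` there
is `k₀` such that for EVERY `N`, every Lennard-Jones ground state `x` of `N` particles in `ℝ³` and
every group `S` of at least `k₀` particles,
`∑_{S×S} V_LJ + 2 ∑_{S×Sᶜ} V_LJ ≤ 2 (e* + η) #S`: deleting `S` is a competitor for `E(N − #S)`
(`removal_group_le`), `E(N) < E(N − #S) + E(#S)` (strict binding, `groundStateEnergy_add_lt`), and
`E(k) ≤ k (e* + η)` for `k ≥ k₀` (`E(k)/k → e*`, `crysEnergyLimit`).  Applied to a particle-centred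
window `S = {j : |x_j − x_i| ≤ L}` it bounds the window's internal energy by `2(e* + η)#S` plus twice
the attraction across its boundary. [folklore] -/
theorem stub_windowRemoval :
    ∀ η : ℝ, 0 < η → ∃ k₀ : ℕ, ∀ (N : ℕ) (x : Fin N → E3), IsGroundState lennardJones x →
      ∀ S : Finset (Fin N), k₀ ≤ S.card →
        ∑ i ∈ S, ∑ k ∈ S, lennardJones (dist (x i) (x k)) +
            2 * ∑ i ∈ S, ∑ k ∈ Sᶜ, lennardJones (dist (x i) (x k)) ≤
          2 * (eStar + η) * S.card := by
  intro η hη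
  -- `E(k) ≤ k (e* + η)` for `k ≥ k₀`, `k₀ ≥ 1`
  have hE : Tendsto (fun N : ℕ => groundStateEnergy lennardJones 3 N / N) atTop (𝓝 eStar) :=
    crysEnergyLimit
  have hev : ∀ᶠ k : ℕ in atTop, groundStateEnergy lennardJones 3 k ≤ (k : ℝ) * (eStar + η) := by
    have h1 : ∀ᶠ k : ℕ in atTop, dist (groundStateEnergy lennardJones 3 k / k) eStar < η :=
      (Metric.tendsto_nhds.1 hE) η hη
    have h2 : ∀ᶠ k : ℕ in atTop, 1 ≤ k := eventually_ge_atTop 1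
    filter_upwards [h1, h2] with k hk hk1
    have hkpos : (0 : ℝ) < k := by exact_mod_cast hk1
    rw [Real.dist_eq, abs_lt, div_sub' (ne_of_gt hkpos), div_lt_iff₀ hkpos] at hk
    linarith [hk.2]
  obtain ⟨k₁, hk₁⟩ := eventually_atTop.1 hev
  refine ⟨max k₁ 1, fun N x hx S hS => ?_⟩
  have hSk₁ : k₁ ≤ S.card := le_trans (le_max_left _ _) hS
  have hS1 : 1 ≤ S.card := le_trans (le_max_right _ _) hS
  have hEk := hk₁ S.card hSk₁
  have hcard : S.card + Sᶜ.card = N := by rw [Finset.card_add_card_compl, Fintype.card_fin]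
  have hrem := removal_group_le hx S
  by_cases hm : Sᶜ.card = 0
  · -- `S` is everything: no cross terms, and `E(N) = E(#S)`
    have hSc : Sᶜ = ∅ := Finset.card_eq_zero.1 hm
    have hN : N = S.card := by omega
    have hE0 : groundStateEnergy lennardJones 3 Sᶜ.card = 0 := by
      rw [hm]
      have h0 : ∀ y : {y : Fin 0 → E3 // Function.Injective y},
          interactionEnergy lennardJones y.1 = 0 :=
        fun y => interactionEnergy_of_subsingleton lennardJones y.1
      haveI : Nonempty {y : Fin 0 → E3 // Function.Injective y} :=
        ⟨⟨fun i => i.elim0, fun i => i.elim0⟩⟩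
      unfold groundStateEnergy
      simp only [h0]
      exact ciInf_const
    have hEN : groundStateEnergy lennardJones 3 N ≤ (S.card : ℝ) * (eStar + η) := by
      have h := hk₁ N (by omega)
      have hc : (N : ℝ) = S.card := by exact_mod_cast hN
      rw [hc] at h
      exact h
    rw [hE0, sub_zero] at hrem
    nlinarith [hrem, hEN]
  · -- strict binding with ground states of sizes `#Sᶜ` and `#S`
    have hmpos : 0 < Sᶜ.card := Nat.pos_of_ne_zero hm
    obtain ⟨y, hy⟩ := LennardJonesGroundStatesExist_holds Sᶜ.card
    obtain ⟨z, hz⟩ := LennardJonesGroundStatesExist_holds S.card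
    have hbind := groundStateEnergy_add_lt (by norm_num : 0 < 3) hmpos hS1 hy hz
    rw [show Sᶜ.card + S.card = N by omega] at hbind
    nlinarith [hrem, hbind, hEk]

end Summit.AtomisticToContinuum.Crystallization.Theorems.LjLaminarWindowsSketch

end
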